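import Summits.BirchSwinnertonDyer.BirchSwinnertonDyer.Theorems.KatoDescentPotSupersingularKatoSelmerSharpBoundFinal
import Summits.BirchSwinnertonDyer.BirchSwinnertonDyer.Theorems.KatoDescentPotSupersingularKatoSelmerPTTurnkey
import HarnessLib

/-!
# The S-side of crux M's level-0 ledger in one line: brick (a) × its Poitou–Tate companion (ii)
# `#Sel_{p^∞}(E/ℚ) · ∏_{ℓ ∈ T∖{p}} #H¹_ur(ℚ_ℓ, E[p^∞]) · [B_k : B_k ⊓ 𝓚_k^⊥] ≤ #Sel_str^{ur}(E[p^∞]) · p^k · [E(ℚ) : p^k E(ℚ)]`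
# (route `KatoDescentPotSupersingular` / `…Tame…`, crux M = stmt-BirchSwinnertonDyer-19196; route-free helper)

Seat `bsd-potss-rkm` g19 (prover; cell `bsd-potss`), item stmt-BirchSwinnertonDyer-19196 (`--supports … --as helper`; closes nothing).
HONEST FRAMING: BSD is not proved by any of this; nothing is booked; theorems only (no definition, no named fact).

## What

Part 39 (`exists_forall_natCard_kato_mul_relIndex_le`, brick (a)): `#S · [B_k : B_k ⊓ 𝓚_k^⊥] ≤ #Sel_str^{ur} · p^k` for `k ≫ 0`, every Poitou–Tate
family at level `p^j p^k` (`SumLocalTermEqZero`, `IsPerfect`) and every level-`p^j p^k` Weil datum (`B_k = loc_p (desc^♭)_* ι′_* red_{p^k}(H¹(ℤ[1/p], T_pE))`).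
Part 45 (`exists_forall_natCard_selmerGroupPInfty_mul_prod_unramified_le`, (ii)): `#Sel_{p^∞} · ∏_{ℓ∈T∖p} #H¹_ur(ℚ_ℓ,E[p^∞]) ≤ #S · [E(ℚ) : p^k E(ℚ)]` for
`k ≫ 0`, every level-`p^s p^k` Weil datum (alternating, non-degenerate) and every family at level `p^s p^k` (`IsPerfect`, `SelmerComplement`).
Multiplying (no cancellation: `(#Sel·Π)·R ≤ (#S·I)·R = (#S·R)·I ≤ (#Sel_str·p^k)·I`):

* **`exists_forall_sSide_le`** — `∃ j s k₀, ∀ k ≥ k₀`, for all such data at the two auxiliary levels: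
  `#Sel_{p^∞}(E/ℚ) · ∏_{ℓ∈T∖{p}} #H¹_ur(ℚ_ℓ,E[p^∞]) · [B_k : B_k ⊓ 𝓚_k^⊥] ≤ #Sel_str^{ur}(E[p^∞]) · p^k · [E(ℚ) : p^k E(ℚ)]`.

READING (rank `0`, `k ≫ 0`; g18's Néron reading `#H¹_ur(ℚ_ℓ,E[p^∞]) = p^{v_p(c_ℓ)}`, `Sel_{p^∞} = Ш[p^∞]`, `[E(ℚ):p^kE(ℚ)] = #E(ℚ)[p^∞] = p^{t₀}`):
`#Ш[p^∞] · Tam^{(p)}_{≠p} · #im_k(A) ≤ #Sel_str^{ur}(E[p^∞]) · p^{k+t₀}` — (iii)×(ii) of the ledger (Kato, proof of Prop. 14.16), kernel modulo the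
finite-level duality predicates of the two families.  What remains for M: the lower bound for `#im_k(A)` (Kato 14.18 at additive `p`, cell
bsd-addord) and the Iwasawa side (KATO-H2; held child 20297).

References: K. Kato, Astérisque 295 (2004), §14.8, Prop. 14.16 and its proof (pp. 244–245) [Kato2004Asterisque]; J. S. Milne, *ADT* I
Cor. 2.3, Thm. 2.6, Lemma 3.3, Thm. 4.10 (b) [MilneADT2006].
-/

-- the summit and its single problem are both named `BirchSwinnertonDyer` (registry layout D-0017)
set_option linter.dupNamespace false
set_option autoImplicit false

noncomputable section

open scoped Classical ContRepresentation NumberField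
open CategoryTheory Function Field NumberField IsDedekindDomain WeierstrassCurve
open Literature.NumberTheory.EllipticCurves Literature.NumberTheory.GaloisRepresentations
  Literature.NumberTheory.GaloisRepresentations.DiscreteGaloisModule Literature.NumberTheory.GaloisCohomology
open Literature.NumberTheory.EllipticCurves.Kato2004 Literature.NumberTheory.EllipticCurves.Kato2004.EulerSystemValues
open Summit.BirchSwinnertonDyer.Rank1Residual.X11b.Levels Summit.BirchSwinnertonDyer.Rank1Residual.X11b.LocBridge
  Summit.BirchSwinnertonDyer.Rank1Residual.X11b.LevelKummer Summit.BirchSwinnertonDyer.Rank1Residual.X11b.FiniteDuality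
  Summit.BirchSwinnertonDyer.Rank1Residual.X11b.AcSelmer
open Summit.BirchSwinnertonDyer.Rank1Residual.GaloisImage
open Summit.BirchSwinnertonDyer.BirchSwinnertonDyer.Theorems.KummerTowerOrthogonal

namespace Summit.BirchSwinnertonDyer.BirchSwinnertonDyer.Theorems.KatoFiniteLevelCount

section SSide

variable (W : WeierstrassCurve ℚ) [W.IsElliptic] (p : ℕ) [Fact p.Prime] [ContinuousSMul ℤ_[p] (W.tateModule p)]
  (𝓤inf 𝓢inf : SelmerStructure (primaryGaloisModule W p))

/-- **THE S-SIDE OF CRUX M'S LEVEL-0 LEDGER: `#Sel_{p^∞} · ∏_{ℓ∈T∖{p}} #H¹_ur(ℚ_ℓ,E[p^∞]) · [B_k : B_k ⊓ 𝓚_k^⊥] ≤ #Sel_str^{ur} · p^k · [E(ℚ) : p^k E(ℚ)]`**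
for all `k ≥ k₀` — brick (a) (part 39) times its Poitou–Tate companion (ii) (part 45).  Hypotheses: `p` odd; `T ∋ v_p` with good reduction off `T`;
`Sel_{p^∞}(E/ℚ)` and `Ш(E/ℚ)[p^∞]` finite; Kato's structures `𝓤∞` / `𝓢∞`; then for every Poitou–Tate family `inv` at level `p^j p^k`
(`SumLocalTermEqZero`, `IsPerfect`) with a level-`p^j p^k` Weil datum `ε`, and every family `inv'` at level `p^s p^k` (`IsPerfect`, `SelmerComplement`)
with an alternating non-degenerate level-`p^s p^k` Weil datum `e`.  In rank `0` this reads `#Ш[p^∞] · Tam^{(p)}_{≠p} · #im_k(A) ≤ #Sel_str^{ur} · p^{k+t₀}`.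
[cite: Kato2004Asterisque, §14.8 (p. 238), Prop. 14.16 and its proof (pp. 244–245)] [cite: MilneADT2006, Ch. I, Cor. 2.3, Lemma 3.3, Thm. 4.10 (b)] -/
theorem exists_forall_sSide_le (hodd : p ≠ 2) (T : Finset (HeightOneSpectrum (𝓞 ℚ)))
    (hpT : primePlace p ∈ T) (hT : ∀ v : HeightOneSpectrum (𝓞 ℚ), v ∉ T → W.HasGoodReductionAt v)
    [Finite (W.selmerGroupPInfty p)] [Finite (AddCommGroup.primaryComponent (↥W.sha) p)]
    (hUp : 𝓤inf (Sum.inr (primePlace p)) = ⊤)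
    (hUur : ∀ v : HeightOneSpectrum (𝓞 ℚ), v ≠ primePlace p →
      𝓤inf (Sum.inr v) = unramifiedSubgroup (GaloisRep.toLocal v (primaryGaloisModule W p)) 1)
    (hUinl : ∀ w : InfinitePlace ℚ, 𝓤inf (Sum.inl w) = ⊤)
    (hSp : 𝓢inf (Sum.inr (primePlace p)) = ⊥)
    (hSur : ∀ v : HeightOneSpectrum (𝓞 ℚ), v ≠ primePlace p →
      𝓢inf (Sum.inr v) = unramifiedSubgroup (GaloisRep.toLocal v (primaryGaloisModule W p)) 1)
    (hSinl : ∀ w : InfinitePlace ℚ, 𝓢inf (Sum.inl w) = ⊤) :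
    ∃ j s k₀ : ℕ, ∀ k : ℕ, k₀ ≤ k →
      haveI := neZero_pow p j; haveI := neZero_pow p s; haveI := neZero_pow p k
      haveI : Finite (geomTorsion W ((p ^ k : ℕ) : ℤ)) := finite_geomTorsion_pow W p k
      haveI : Finite (geomTorsion W ((p ^ s * p ^ k : ℕ) : ℤ)) :=
        W.finite_torsionPoints_holds (AlgebraicClosure ℚ) (Int.natCast_ne_zero.mpr (NeZero.ne (p ^ s * p ^ k)))
      ∀ (inv : LocalInvariants ℚ (p ^ j * p ^ k)), inv.SumLocalTermEqZero → inv.IsPerfect →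
      ∀ (ε : geomTorsion W ((p ^ j * p ^ k : ℕ) : ℤ) → geomTorsion W ((p ^ j * p ^ k : ℕ) : ℤ) → AlgebraicClosure ℚ)
        (hμ : ∀ S T, ε S T ^ (p ^ j * p ^ k) = 1)
        (hadd₁ : ∀ S₁ S₂ T, ε (S₁ + S₂) T = ε S₁ T * ε S₂ T)
        (hadd₂ : ∀ S T₁ T₂, ε S (T₁ + T₂) = ε S T₁ * ε S T₂)
        (hgal : ∀ (σ : absoluteGaloisGroup ℚ) (S T : geomTorsion W ((p ^ j * p ^ k : ℕ) : ℤ)), σ • ε S T = ε (σ • S) (σ • T)),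
      ∀ (e : geomTorsion W ((p ^ s * p ^ k : ℕ) : ℤ) → geomTorsion W ((p ^ s * p ^ k : ℕ) : ℤ) → AlgebraicClosure ℚ)
        (hμ' : ∀ S T, e S T ^ (p ^ s * p ^ k) = 1)
        (hadd₁' : ∀ S₁ S₂ T, e (S₁ + S₂) T = e S₁ T * e S₂ T)
        (hadd₂' : ∀ S T₁ T₂, e S (T₁ + T₂) = e S T₁ * e S T₂)
        (hgal' : ∀ (σ : absoluteGaloisGroup ℚ) (S T : geomTorsion W ((p ^ s * p ^ k : ℕ) : ℤ)), σ • e S T = e (σ • S) (σ • T)),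
        (∀ P, e P P = 1) → (∀ P, (∀ Q, e Q P = 1) → P = 0) →
      ∀ (inv' : LocalInvariants ℚ (p ^ s * p ^ k)), inv'.IsPerfect → inv'.SelmerComplement →
      Nat.card (W.selmerGroupPInfty p) *
            (∏ v ∈ T \ {primePlace p}, Nat.card (unramifiedSubgroup (GaloisRep.toLocal v (primaryGaloisModule W p)) 1)) *
            ((((integralH1 (tateRep W p) p ⊤).toAddSubgroup.map
                  (((galoisCohomology.map (W.torsionInclusion (intPow_dvd_natCast_pow p k)) 1).comp
                      (ofTopSubgroup (W.torsionGaloisModule ((p : ℤ) ^ k)).toTopRep 1).hom.toLinearMap.toAddMonoidHom).comp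
                    (reduceH1Pk W p k ⊤))).map
                  (galoisCohomology.map (DiscreteGaloisModule.pairingDualIntertwining
                    (ρ₁ := W.torsionGaloisModule ((p ^ k : ℕ) : ℤ)) (ρ₂ := W.torsionGaloisModule ((p ^ k : ℕ) : ℤ))
                    (B := descendHom W (p ^ j) (p ^ k) ε hμ hadd₁ hadd₂)
                    (descendHom_smul W (p ^ j) (p ^ k) ε hμ hadd₁ hadd₂ hgal)) 1)).map
                (galoisCohomology.localization ((W.torsionGaloisModule ((p ^ k : ℕ) : ℤ)).tateDual (p ^ j * p ^ k))
                  (Sum.inr (primePlace p)) 1) ⊓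
              annRight (localTatePairingZMod (W.torsionGaloisModule ((p ^ k : ℕ) : ℤ)) (p ^ j * p ^ k)
                (Sum.inr (primePlace p)) (inv (Sum.inr (primePlace p))))
                (W.kummerSelmerStructure ((p ^ k : ℕ) : ℤ) (Sum.inr (primePlace p)))).relIndex
              ((((integralH1 (tateRep W p) p ⊤).toAddSubgroup.map
                  (((galoisCohomology.map (W.torsionInclusion (intPow_dvd_natCast_pow p k)) 1).comp
                      (ofTopSubgroup (W.torsionGaloisModule ((p : ℤ) ^ k)).toTopRep 1).hom.toLinearMap.toAddMonoidHom).comp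
                    (reduceH1Pk W p k ⊤))).map
                  (galoisCohomology.map (DiscreteGaloisModule.pairingDualIntertwining
                    (ρ₁ := W.torsionGaloisModule ((p ^ k : ℕ) : ℤ)) (ρ₂ := W.torsionGaloisModule ((p ^ k : ℕ) : ℤ))
                    (B := descendHom W (p ^ j) (p ^ k) ε hμ hadd₁ hadd₂)
                    (descendHom_smul W (p ^ j) (p ^ k) ε hμ hadd₁ hadd₂ hgal)) 1)).map
                (galoisCohomology.localization ((W.torsionGaloisModule ((p ^ k : ℕ) : ℤ)).tateDual (p ^ j * p ^ k))
                  (Sum.inr (primePlace p)) 1)) ≤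
        Nat.card 𝓢inf.selmerGroup * p ^ k *
          (zsmulAddGroupHom ((p ^ k : ℕ) : ℤ) : W.toAffine.Point →+ W.toAffine.Point).range.index := by
  obtain ⟨j, k₁, hA⟩ := exists_forall_natCard_kato_mul_relIndex_le W p 𝓤inf 𝓢inf hodd T hpT hT hUp hUur hUinl hSp hSur hSinl
  obtain ⟨s, k₂, hB⟩ := exists_forall_natCard_selmerGroupPInfty_mul_prod_unramified_le W p T hodd hpT hT 𝓤inf hUp hUur hUinl
  refine ⟨j, s, max k₁ k₂, fun k hk => ?_⟩
  intro inv hsum hperf ε hμ hadd₁ hadd₂ hgal e hμ' hadd₁' hadd₂' hgal' halt hnondeg inv' hperf' hcompl'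
  have h1 := hA k ((le_max_left _ _).trans hk) inv hsum hperf ε hμ hadd₁ hadd₂ hgal
  have h2 := hB k ((le_max_right _ _).trans hk) e hμ' hadd₁' hadd₂' hgal' halt hnondeg inv' hperf' hcompl'
  exact (Nat.mul_le_mul_right _ h2).trans
    ((Nat.mul_right_comm _ _ _).le.trans (Nat.mul_le_mul_right _ h1))

end SSide

end Summit.BirchSwinnertonDyer.BirchSwinnertonDyer.Theorems.KatoFiniteLevelCount

end
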